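import Summits.ABC.ABC.Theses.CuspFieldPencil
import HarnessLib

/-!
# Glue: NF pencil theorem + golden instance ⇒ golden cusp shadow

`Summits/ABC/ABC/Theorems/CuspFieldPencilGoldenCuspShadowGlue.lean` — proves the glue item
stmt-ABC-26252 `Summit.ABC.ABC.Theses.CuspFieldPencil.GoldenCuspShadowGlue` of the (draft)
class-record route `CuspFieldPencil`:

`NFPencilBound → GoldenFromNFPencil → GoldenCuspShadow` — modus ponens (`GoldenFromNFPencil` is by
definition `NFPencilBound → GoldenCuspShadow`).

HONESTY. Pure-logic glue of a CLASS RECORD at abc distance 0 (width 0): NOT abc, NOT A-PS; the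
load-bearing children `NFPencilBound` (stmt-ABC-26250) and `GoldenFromNFPencil` (stmt-ABC-26251)
are not proved here; abc moved by 0; typed ≠ proved.
-/

set_option linter.dupNamespace false

namespace Summit.ABC.ABC.Theorems

/-- Glue item stmt-ABC-26252: the parametric number-field pencil theorem `NFPencilBound` together
with its golden specialisation `GoldenFromNFPencil : NFPencilBound → GoldenCuspShadow` yields the
golden cusp shadow `GoldenCuspShadow` (modus ponens). -/
theorem goldenCuspShadowGlue_proof : Summit.ABC.ABC.Theses.CuspFieldPencil.GoldenCuspShadowGlue := by
  unfold Summit.ABC.ABC.Theses.CuspFieldPencil.GoldenCuspShadowGlue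
    Summit.ABC.ABC.Theses.CuspFieldPencil.GoldenFromNFPencil
  exact fun h₁ h₂ => h₂ h₁

end Summit.ABC.ABC.Theorems
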